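import Summits.PneNP.PneNP.Theorems.ConvexRankGatesConvexGateBlindExactLiftingTriangleRegroupingRigidityOfCov

/-!
# Triangle instance — the vertex view: ends of lines, colour flips, robust nondegenerate rows, and explicit
# biorthogonal functionals for the line patterns

Support file for crux `ConvexGateBlind` (stmt-PneNP-10680), open stub `stub_exactLifting`; prover seat 0, session 36,
memo ANALYSIS15 §1. First of three files proving REGROUPING RIGIDITY of the cheap corner of the triangle matrix `M_t`
UNCONDITIONALLY (superseding the combinatorial COV route of `…TriangleRegroupingRigidityOfCov` / `…TriangleCovDuality`):
the lines are the only `≤ 3t²`-term non-negative factorisation of `M_t` with generators in `cone{1_L}` (`t ≥ 4`).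

The mechanism is linear algebra on the `0/1` matrix `N[x,L] = [L monochromatic under x]` (nondegenerate rows `x`): this file
supplies, for every line `L₀ = {p, q}`, an explicit functional — the four-point inclusion–exclusion
`Φ_{L₀}(g) = g(x₀) − g(x₀^p) − g(x₀^q) + g(x₀^{pq})` at a suitable nondegenerate row `x₀` whose three flips stay nondegenerate —
with `Φ_{L₀}([· mono L]) = 2·[L = L₀]` (`dfun_mInd_line`, registered form `triangle_line_biorthogonal`). In particular the `3t²`
line patterns are linearly independent on nondegenerate rows, which already gives the covering bound `R ≥ 3t²` for regroupings.
Vocabulary: vertices `Fin 3 × Fin t` (block, index), the two ends `e1 L`, `e2 L` of a line and its third block `tb L`, the line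
`vline v w` through two vertices of different blocks, the colour flip `flipV v x` and its effect on the line patterns
(`mInd_flipV`), and ROBUST rows (`Robust S x`: every block shows both colours outside `S`), which stay nondegenerate under flips
inside `S` and exist with prescribed colours on `S` as soon as `t ≥ 4` and `S` has at most two vertices per block.
-/

set_option linter.dupNamespace false -- `Summit.PneNP.PneNP.…`: summit = sub-problem (D-0017)

namespace Summit.PneNP.PneNP.Theorems.XorDoor.TriLine

open Finset

noncomputable section

variable {t : ℕ}

/-! ## Vertices and colours -/

/-- a vertex of `K_{t,t,t}`: (block, index) -/
abbrev Vtx (t : ℕ) := Fin 3 × Fin t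

/-- the three block colourings as one function of the block -/
def col (x : Col t) : Fin 3 → Fin t → Bool := ![x.1, x.2.1, x.2.2]

/-- back from a function of the block to a triple of colourings -/
def ofCol (y : Fin 3 → Fin t → Bool) : Col t := (y 0, y 1, y 2)

/-- block `0` -/
@[simp] lemma col_zero (x : Col t) : col x 0 = x.1 := rfl
/-- block `1` -/
@[simp] lemma col_one (x : Col t) : col x 1 = x.2.1 := rfl
/-- block `2` -/
@[simp] lemma col_two (x : Col t) : col x 2 = x.2.2 := rfl

/-- `col ∘ ofCol = id` -/
@[simp] lemma col_ofCol (y : Fin 3 → Fin t → Bool) : col (ofCol y) = y := by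
  funext i; fin_cases i <;> rfl

/-! ## Ends of lines -/

/-- the first end of a line (the one in the smaller block) -/
def e1 : Line t → Vtx t
  | Sum.inl ab => (0, ab.1)
  | Sum.inr (Sum.inl ad) => (0, ad.1)
  | Sum.inr (Sum.inr bd) => (1, bd.1)

/-- the second end of a line (the one in the larger block) -/
def e2 : Line t → Vtx t
  | Sum.inl ab => (1, ab.2)
  | Sum.inr (Sum.inl ad) => (2, ad.2)
  | Sum.inr (Sum.inr bd) => (2, bd.2)

/-- the third block of a line (the block containing neither end) -/
def tb : Line t → Fin 3
  | Sum.inl _ => 2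
  | Sum.inr (Sum.inl _) => 1
  | Sum.inr (Sum.inr _) => 0

/-- `v` is an end of `L` -/
def onL (v : Vtx t) (L : Line t) : Prop := v = e1 L ∨ v = e2 L

/-- being an end is decidable -/
instance (v : Vtx t) (L : Line t) : Decidable (onL v L) := by unfold onL; infer_instance

/-- the two ends lie in different blocks, the first in the smaller one -/
lemma e1_fst_lt_e2_fst (L : Line t) : (e1 L).1 < (e2 L).1 := by
  rcases L with ab | ad | bd <;> simp [e1, e2]

/-- the two ends are different vertices -/
lemma e1_ne_e2 (L : Line t) : e1 L ≠ e2 L := fun h =>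
  absurd (congrArg Prod.fst h) (ne_of_lt (e1_fst_lt_e2_fst L))

/-- the third block is not the block of the first end -/
lemma tb_ne_e1_fst (L : Line t) : tb L ≠ (e1 L).1 := by
  rcases L with ab | ad | bd <;> simp [e1, tb]

/-- the third block is not the block of the second end -/
lemma tb_ne_e2_fst (L : Line t) : tb L ≠ (e2 L).1 := by
  rcases L with ab | ad | bd <;> simp [e2, tb]

/-- every block is the block of an end or the third block -/
lemma block_cases (L : Line t) (i : Fin 3) : i = (e1 L).1 ∨ i = (e2 L).1 ∨ i = tb L := by
  rcases L with ab | ad | bd <;> fin_cases i <;> simp [e1, e2, tb]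

/-- an end is not in the third block -/
lemma fst_ne_tb_of_onL {v : Vtx t} {L : Line t} (h : onL v L) : v.1 ≠ tb L := by
  rcases h with h | h <;> rw [h]
  · exact (tb_ne_e1_fst L).symm
  · exact (tb_ne_e2_fst L).symm

/-- a line is determined by its two ends -/
lemma ends_inj {L L' : Line t} (h1 : e1 L = e1 L') (h2 : e2 L = e2 L') : L = L' := by
  rcases L with ⟨a, b⟩ | ⟨a, d⟩ | ⟨b, d⟩ <;> rcases L' with ⟨a', b'⟩ | ⟨a', d'⟩ | ⟨b', d'⟩ <;>
    simp_all [e1, e2, Prod.ext_iff]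

/-- monochromaticity of a line = its two ends have the same colour -/
lemma lmono_iff_col (x : Col t) (L : Line t) : lmono x L ↔ col x (e1 L).1 (e1 L).2 = col x (e2 L).1 (e2 L).2 := by
  rcases L with ⟨a, b⟩ | ⟨a, d⟩ | ⟨b, d⟩ <;> simp [e1, e2]

/-- two different ends of a line lie in different blocks -/
lemma fst_ne_fst_of_onL {v w : Vtx t} {L : Line t} (hv : onL v L) (hw : onL w L) (hvw : v ≠ w) : v.1 ≠ w.1 := by
  have hlt := e1_fst_lt_e2_fst L
  rcases hv with hv | hv <;> rcases hw with hw | hw <;> subst hv <;> subst hw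
  · exact absurd rfl hvw
  · exact ne_of_lt hlt
  · exact (ne_of_lt hlt).symm
  · exact absurd rfl hvw

/-! ## The line through two vertices -/

/-- the line through two vertices of different blocks (an arbitrary line if the blocks coincide) -/
def vline (v w : Vtx t) : Line t :=
  if v.1 = 0 ∧ w.1 = 1 then Sum.inl (v.2, w.2)
  else if v.1 = 1 ∧ w.1 = 0 then Sum.inl (w.2, v.2)
  else if v.1 = 0 ∧ w.1 = 2 then Sum.inr (Sum.inl (v.2, w.2))
  else if v.1 = 2 ∧ w.1 = 0 then Sum.inr (Sum.inl (w.2, v.2))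
  else if v.1 = 1 then Sum.inr (Sum.inr (v.2, w.2))
  else Sum.inr (Sum.inr (w.2, v.2))

/-- the ends of `vline v w` are `v` and `w` -/
lemma ends_vline {v w : Vtx t} (h : v.1 ≠ w.1) :
    (e1 (vline v w) = v ∧ e2 (vline v w) = w) ∨ (e1 (vline v w) = w ∧ e2 (vline v w) = v) := by
  obtain ⟨i, k⟩ := v
  obtain ⟨j, l⟩ := w
  fin_cases i <;> fin_cases j <;> simp_all [vline, e1, e2]

/-- `v` is an end of `vline v w` -/
lemma onL_vline_left {v w : Vtx t} (h : v.1 ≠ w.1) : onL v (vline v w) := by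
  rcases ends_vline h with ⟨h1, -⟩ | ⟨-, h2⟩
  · exact Or.inl h1.symm
  · exact Or.inr h2.symm

/-- `w` is an end of `vline v w` -/
lemma onL_vline_right {v w : Vtx t} (h : v.1 ≠ w.1) : onL w (vline v w) := by
  rcases ends_vline h with ⟨-, h2⟩ | ⟨h1, -⟩
  · exact Or.inr h2.symm
  · exact Or.inl h1.symm

/-- the line through the two ends of `L` is `L` -/
lemma vline_e1_e2 (L : Line t) : vline (e1 L) (e2 L) = L := by
  rcases L with ⟨a, b⟩ | ⟨a, d⟩ | ⟨b, d⟩ <;> simp [vline, e1, e2]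

/-- the line through the two ends of `L`, in the other order, is `L` -/
lemma vline_e2_e1 (L : Line t) : vline (e2 L) (e1 L) = L := by
  rcases L with ⟨a, b⟩ | ⟨a, d⟩ | ⟨b, d⟩ <;> simp [vline, e1, e2]

/-- a line containing two different vertices is the line through them -/
lemma eq_vline {L : Line t} {v w : Vtx t} (hv : onL v L) (hw : onL w L) (hvw : v ≠ w) : L = vline v w := by
  rcases hv with hv | hv <;> rcases hw with hw | hw <;> subst hv <;> subst hw
  · exact absurd rfl hvw
  · exact (vline_e1_e2 L).symm
  · exact (vline_e2_e1 L).symm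
  · exact absurd rfl hvw

/-- `vline` is symmetric on vertices of different blocks -/
lemma vline_comm {v w : Vtx t} (h : v.1 ≠ w.1) : vline v w = vline w v :=
  eq_vline (onL_vline_right h) (onL_vline_left h) fun hwv => h (congrArg Prod.fst hwv).symm

/-- two vertices of different blocks are both ends of `L` iff `L` is the line through them -/
lemma onL_and_onL_iff {p q : Vtx t} (hpq : p.1 ≠ q.1) (L : Line t) : (onL p L ∧ onL q L) ↔ L = vline p q := by
  constructor
  · rintro ⟨hp, hq⟩
    exact eq_vline hp hq fun h => hpq (congrArg Prod.fst h)
  · rintro rfl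
    exact ⟨onL_vline_left hpq, onL_vline_right hpq⟩

/-- the block of a vertex of `vline v w` other than the blocks of `v`, `w` is its third block -/
lemma tb_vline {v w : Vtx t} (h : v.1 ≠ w.1) {i : Fin 3} (hv : i ≠ v.1) (hw : i ≠ w.1) : tb (vline v w) = i := by
  rcases block_cases (vline v w) i with h1 | h2 | h3
  · rcases ends_vline h with ⟨e, -⟩ | ⟨e, -⟩ <;> rw [e] at h1
    · exact absurd h1 hv
    · exact absurd h1 hw
  · rcases ends_vline h with ⟨-, e⟩ | ⟨-, e⟩ <;> rw [e] at h2
    · exact absurd h2 hw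
    · exact absurd h2 hv
  · exact h3.symm

/-- a vertex of the third block is not an end -/
lemma not_onL_of_fst_eq_tb {r : Vtx t} {L : Line t} (h : r.1 = tb L) : ¬ onL r L :=
  fun hr => fst_ne_tb_of_onL hr h

/-! ## Colour flips -/

/-- flip the colour of the vertex `v` -/
def flipV (v : Vtx t) (x : Col t) : Col t := ofCol fun i k => if (i, k) = v then !(col x i k) else col x i k

/-- colours after a flip -/
@[simp] lemma col_flipV (v : Vtx t) (x : Col t) (i : Fin 3) (k : Fin t) :
    col (flipV v x) i k = if (i, k) = v then !(col x i k) else col x i k := by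
  simp [flipV]

/-- **Effect of a flip on a line pattern**: toggled iff the flipped vertex is an end. -/
lemma lmono_flipV (v : Vtx t) (x : Col t) (L : Line t) : lmono (flipV v x) L ↔ (onL v L ↔ ¬ lmono x L) := by
  rw [lmono_iff_col, lmono_iff_col, col_flipV, col_flipV, Prod.mk.eta, Prod.mk.eta]
  have hne : e1 L ≠ e2 L := e1_ne_e2 L
  unfold onL
  by_cases h1 : v = e1 L
  · subst h1
    rw [if_pos rfl, if_neg (Ne.symm hne)]
    cases col x (e1 L).1 (e1 L).2 <;> cases col x (e2 L).1 (e2 L).2 <;> simp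
  · by_cases h2 : v = e2 L
    · subst h2
      rw [if_neg hne, if_pos rfl]
      cases col x (e1 L).1 (e1 L).2 <;> cases col x (e2 L).1 (e2 L).2 <;> simp
    · rw [if_neg (Ne.symm h1), if_neg (Ne.symm h2)]
      simp [h1, h2]

/-- **Effect of a flip on `mInd`**: `mInd (x^v) L = 1 − mInd x L` if `v` is an end of `L`, unchanged otherwise. -/
lemma mInd_flipV (v : Vtx t) (x : Col t) (L : Line t) :
    mInd (flipV v x) L = if onL v L then 1 - mInd x L else mInd x L := by
  have h := lmono_flipV v x L
  unfold mInd
  by_cases hv : onL v L <;> by_cases hm : lmono x L <;> simp_all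

/-! ## Robust rows -/

/-- `x` is ROBUST outside `S`: every block has two vertices outside `S` of different colours (so `x`, and every row obtained
from it by flips inside `S`, is nondegenerate) -/
def Robust (S : Finset (Vtx t)) (x : Col t) : Prop :=
  ∀ i : Fin 3, ∃ k k' : Fin t, (i, k) ∉ S ∧ (i, k') ∉ S ∧ col x i k ≠ col x i k'

/-- a robust row is nondegenerate -/
lemma mu_ne_zero_of_robust {S : Finset (Vtx t)} {x : Col t} (h : Robust S x) : mu x ≠ 0 := by
  rw [mu_ne_zero_iff_two_coloured]
  obtain ⟨k₀, k₀', -, -, h₀⟩ := h 0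
  obtain ⟨k₁, k₁', -, -, h₁⟩ := h 1
  obtain ⟨k₂, k₂', -, -, h₂⟩ := h 2
  exact ⟨⟨k₀, k₀', h₀⟩, ⟨k₁, k₁', h₁⟩, ⟨k₂, k₂', h₂⟩⟩

/-- robustness survives a flip inside `S` -/
lemma robust_flipV {S : Finset (Vtx t)} {x : Col t} (h : Robust S x) {v : Vtx t} (hv : v ∈ S) :
    Robust S (flipV v x) := by
  intro i
  obtain ⟨k, k', hk, hk', hne⟩ := h i
  refine ⟨k, k', hk, hk', ?_⟩
  have h1 : ((i, k) : Vtx t) ≠ v := fun e => hk (e ▸ hv)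
  have h2 : ((i, k') : Vtx t) ≠ v := fun e => hk' (e ▸ hv)
  rwa [col_flipV, col_flipV, if_neg h1, if_neg h2]

/-- **Robust rows with prescribed colours exist** (`t ≥ 4`, at most two prescribed vertices per block). -/
lemma exists_robust (ht : 4 ≤ t) (S : Finset (Vtx t)) (hS : ∀ i : Fin 3, (S.filter fun v => v.1 = i).card ≤ 2)
    (req : Vtx t → Bool) : ∃ x : Col t, Robust S x ∧ ∀ v ∈ S, col x v.1 v.2 = req v := by
  classical
  have hfree : ∀ i : Fin 3, ∃ k k' : Fin t, (i, k) ∉ S ∧ (i, k') ∉ S ∧ k ≠ k' := by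
    intro i
    have hG : (univ.filter fun k : Fin t => (i, k) ∈ S).card ≤ 2 := by
      refine le_trans (card_le_card_of_injOn (fun k => ((i, k) : Vtx t)) ?_ ?_) (hS i)
      · intro k hk
        simp only [coe_filter, mem_univ, true_and, Set.mem_setOf_eq] at hk
        simp only [coe_filter, Set.mem_setOf_eq]
        exact ⟨hk, by simp⟩
      · intro k _ k' _ hkk'
        exact (Prod.mk.inj hkk').2
    have hsum := card_filter_add_card_filter_not (s := (univ : Finset (Fin t))) (fun k : Fin t => (i, k) ∈ S)
    rw [card_univ, Fintype.card_fin] at hsum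
    have hF : 1 < (univ.filter fun k : Fin t => ¬ (i, k) ∈ S).card := by omega
    obtain ⟨k, hk, k', hk', hne⟩ := one_lt_card.1 hF
    simp only [mem_filter, mem_univ, true_and] at hk hk'
    exact ⟨k, k', hk, hk', hne⟩
  choose f g hf hg hfg using hfree
  refine ⟨ofCol fun i k => if (i, k) ∈ S then req (i, k) else decide (k = f i), ?_, ?_⟩
  · intro i
    refine ⟨f i, g i, hf i, hg i, ?_⟩
    simp [hf i, hg i, (hfg i).symm]
  · intro v hv
    simp [hv]

/-! ## The four-point functionals -/

/-- the four-point inclusion–exclusion functional at `x` with flips at `p` and `q` -/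
def dfun (x : Col t) (p q : Vtx t) (g : Col t → ℝ) : ℝ :=
  g x - g (flipV p x) - g (flipV q x) + g (flipV p (flipV q x))

/-- **The functional on a line pattern**: `4·mInd x L − 2` if both `p` and `q` are ends of `L`, else `0`. -/
lemma dfun_mInd (x : Col t) (p q : Vtx t) (L : Line t) :
    dfun x p q (fun y => mInd y L) = if onL p L ∧ onL q L then 4 * mInd x L - 2 else 0 := by
  simp only [dfun, mInd_flipV]
  by_cases hp : onL p L
  · by_cases hq : onL q L
    · simp [hp, hq]; ring
    · simp [hp, hq]
  · by_cases hq : onL q L <;> simp [hp, hq]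

/-- the functional is linear: it commutes with finite linear combinations -/
lemma dfun_sum {ι : Type} (s : Finset ι) (x : Col t) (p q : Vtx t) (c : ι → ℝ) (g : ι → Col t → ℝ) :
    dfun x p q (fun y => ∑ i ∈ s, c i * g i y) = ∑ i ∈ s, c i * dfun x p q (g i) := by
  simp only [dfun, mul_sub, mul_add, sum_add_distrib, sum_sub_distrib]

/-- the base row of the functional of `L₀`: robust outside the two ends, both ends coloured `true` -/
lemma exists_base (ht : 4 ≤ t) (L₀ : Line t) :
    ∃ x₀ : Col t, Robust ({e1 L₀, e2 L₀} : Finset (Vtx t)) x₀ ∧ col x₀ (e1 L₀).1 (e1 L₀).2 = true ∧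
      col x₀ (e2 L₀).1 (e2 L₀).2 = true := by
  classical
  have hS : ∀ i : Fin 3, (({e1 L₀, e2 L₀} : Finset (Vtx t)).filter fun v => v.1 = i).card ≤ 2 :=
    fun i => le_trans (card_filter_le _ _) (card_insert_le _ _)
  obtain ⟨x₀, hR, hreq⟩ := exists_robust ht ({e1 L₀, e2 L₀} : Finset (Vtx t)) hS (fun _ => true)
  exact ⟨x₀, hR, hreq _ (by simp), hreq _ (by simp)⟩

/-- the base row of `L₀` (a choice) -/
def base (ht : 4 ≤ t) (L₀ : Line t) : Col t := (exists_base ht L₀).choose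

/-- the defining properties of the base row -/
lemma base_spec (ht : 4 ≤ t) (L₀ : Line t) : Robust ({e1 L₀, e2 L₀} : Finset (Vtx t)) (base ht L₀) ∧
    col (base ht L₀) (e1 L₀).1 (e1 L₀).2 = true ∧ col (base ht L₀) (e2 L₀).1 (e2 L₀).2 = true :=
  (exists_base ht L₀).choose_spec

/-- the base row is robust outside the ends of `L₀` -/
lemma base_robust (ht : 4 ≤ t) (L₀ : Line t) : Robust ({e1 L₀, e2 L₀} : Finset (Vtx t)) (base ht L₀) :=
  (base_spec ht L₀).1

/-- `L₀` is monochromatic under its base row -/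
lemma mInd_base (ht : 4 ≤ t) (L₀ : Line t) : mInd (base ht L₀) L₀ = 1 := by
  have h := base_spec ht L₀
  have hm : lmono (base ht L₀) L₀ := by rw [lmono_iff_col, h.2.1, h.2.2]
  unfold mInd
  rw [if_pos hm]

/-- the functional of the line `L₀`: `Φ_{L₀}(g) = g(x₀) − g(x₀^p) − g(x₀^q) + g(x₀^{pq})`, `p, q` the ends of `L₀` -/
def lfun (ht : 4 ≤ t) (L₀ : Line t) (g : Col t → ℝ) : ℝ := dfun (base ht L₀) (e1 L₀) (e2 L₀) g

/-- **Biorthogonality**: `Φ_{L₀}([· mono L]) = 2·[L = L₀]`. -/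
theorem lfun_mInd (ht : 4 ≤ t) (L₀ L : Line t) : lfun ht L₀ (fun y => mInd y L) = if L = L₀ then 2 else 0 := by
  unfold lfun
  rw [dfun_mInd]
  have hiff : (onL (e1 L₀) L ∧ onL (e2 L₀) L) ↔ L = L₀ := by
    rw [onL_and_onL_iff (ne_of_lt (e1_fst_lt_e2_fst L₀)), vline_e1_e2]
  by_cases h : L = L₀
  · rw [if_pos (hiff.2 h), if_pos h, h, mInd_base]; norm_num
  · rw [if_neg (fun hc => h (hiff.1 hc)), if_neg h]

/-- the functional of `L₀` commutes with finite linear combinations -/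
lemma lfun_sum {ι : Type} (s : Finset ι) (ht : 4 ≤ t) (L₀ : Line t) (c : ι → ℝ) (g : ι → Col t → ℝ) :
    lfun ht L₀ (fun y => ∑ i ∈ s, c i * g i y) = ∑ i ∈ s, c i * lfun ht L₀ (g i) :=
  dfun_sum s _ _ _ c g

/-- **The four rows of the functional are nondegenerate.** -/
lemma lfun_rows_nondeg (ht : 4 ≤ t) (L₀ : Line t) :
    mu (base ht L₀) ≠ 0 ∧ mu (flipV (e1 L₀) (base ht L₀)) ≠ 0 ∧ mu (flipV (e2 L₀) (base ht L₀)) ≠ 0 ∧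
      mu (flipV (e1 L₀) (flipV (e2 L₀) (base ht L₀))) ≠ 0 := by
  have hR := base_robust ht L₀
  have h1 : e1 L₀ ∈ ({e1 L₀, e2 L₀} : Finset (Vtx t)) := by simp
  have h2 : e2 L₀ ∈ ({e1 L₀, e2 L₀} : Finset (Vtx t)) := by simp
  exact ⟨mu_ne_zero_of_robust hR, mu_ne_zero_of_robust (robust_flipV hR h1), mu_ne_zero_of_robust (robust_flipV hR h2),
    mu_ne_zero_of_robust (robust_flipV (robust_flipV hR h2) h1)⟩

/-- **The functional only sees nondegenerate rows**: if `g = g'` on nondegenerate rows then `Φ_{L₀}(g) = Φ_{L₀}(g')`. -/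
lemma lfun_congr (ht : 4 ≤ t) (L₀ : Line t) {g g' : Col t → ℝ} (h : ∀ x, mu x ≠ 0 → g x = g' x) :
    lfun ht L₀ g = lfun ht L₀ g' := by
  obtain ⟨h0, h1, h2, h3⟩ := lfun_rows_nondeg ht L₀
  unfold lfun dfun
  rw [h _ h0, h _ h1, h _ h2, h _ h3]

/-- **Explicit biorthogonal functionals for the line patterns** (registered sub-goal `triangle_line_biorthogonal` of
stmt-PneNP-10680, verbatim signature, self-contained vocabulary): for `t ≥ 4` and every line `L₀` there are four rows, each
two-coloured on every block, whose signed combination `+ − − +` of the line patterns `[L mono]` is `2·[L = L₀]`. Hence the `3t²`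
line patterns are linearly independent on nondegenerate rows. -/
theorem triangle_line_biorthogonal : ∀ (t : ℕ), 4 ≤ t → ∀ L₀ : (Fin t × Fin t) ⊕ (Fin t × Fin t) ⊕ (Fin t × Fin t),
    ∃ x₀ x₁ x₂ x₃ : (Fin t → Bool) × (Fin t → Bool) × (Fin t → Bool), (∀ x ∈ [x₀, x₁, x₂, x₃], (∃ a a', x.1 a ≠ x.1 a')
    ∧ (∃ b b', x.2.1 b ≠ x.2.1 b') ∧ (∃ d d', x.2.2 d ≠ x.2.2 d')) ∧ ∀ L : (Fin t × Fin t) ⊕ (Fin t × Fin t) ⊕ (Fin t ×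
    Fin t), Sum.elim (fun ab : Fin t × Fin t => if x₀.1 ab.1 = x₀.2.1 ab.2 then (1 : ℝ) else 0) (Sum.elim (fun ad : Fin
    t × Fin t => if x₀.1 ad.1 = x₀.2.2 ad.2 then (1 : ℝ) else 0) (fun bd : Fin t × Fin t => if x₀.2.1 bd.1 = x₀.2.2 bd.2
    then (1 : ℝ) else 0)) L - Sum.elim (fun ab : Fin t × Fin t => if x₁.1 ab.1 = x₁.2.1 ab.2 then (1 : ℝ) else 0)
    (Sum.elim (fun ad : Fin t × Fin t => if x₁.1 ad.1 = x₁.2.2 ad.2 then (1 : ℝ) else 0) (fun bd : Fin t × Fin t => if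
    x₁.2.1 bd.1 = x₁.2.2 bd.2 then (1 : ℝ) else 0)) L - Sum.elim (fun ab : Fin t × Fin t => if x₂.1 ab.1 = x₂.2.1 ab.2
    then (1 : ℝ) else 0) (Sum.elim (fun ad : Fin t × Fin t => if x₂.1 ad.1 = x₂.2.2 ad.2 then (1 : ℝ) else 0) (fun bd :
    Fin t × Fin t => if x₂.2.1 bd.1 = x₂.2.2 bd.2 then (1 : ℝ) else 0)) L + Sum.elim (fun ab : Fin t × Fin t => if x₃.1
    ab.1 = x₃.2.1 ab.2 then (1 : ℝ) else 0) (Sum.elim (fun ad : Fin t × Fin t => if x₃.1 ad.1 = x₃.2.2 ad.2 then (1 : ℝ)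
    else 0) (fun bd : Fin t × Fin t => if x₃.2.1 bd.1 = x₃.2.2 bd.2 then (1 : ℝ) else 0)) L = if L = L₀ then 2 else 0 := by
  intro t ht L₀
  refine ⟨base ht L₀, flipV (e1 L₀) (base ht L₀), flipV (e2 L₀) (base ht L₀),
    flipV (e1 L₀) (flipV (e2 L₀) (base ht L₀)), ?_, fun L => ?_⟩
  · obtain ⟨h0, h1, h2, h3⟩ := lfun_rows_nondeg ht L₀
    intro x hx
    simp only [List.mem_cons, List.mem_nil_iff, or_false] at hx
    rw [← mu_ne_zero_iff_two_coloured]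
    rcases hx with rfl | rfl | rfl | rfl <;> assumption
  · have h := lfun_mInd ht L₀ L
    unfold lfun dfun at h
    simpa only [mInd_eq_elim] using h

end

end Summit.PneNP.PneNP.Theorems.XorDoor.TriLine
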